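import Summits.NavierStokesRegularity.NavierStokesRegularity.Theorems.ExtremiserTransienceNearExtremalTransienceExtremiserLiouvilleConstantSpeedSlideCubicBounds
import Summits.NavierStokesRegularity.NavierStokesRegularity.Theorems.ExtremiserTransienceNearExtremalTransienceExtremiserLiouvilleConstantSpeedSlideInequalityLayer
import HarnessLib

/-!
# Crux `ExtremiserTransience.NearExtremalTransience` (stmt-NavierStokesRegularity-21883), line `extremiser_liouville`,
# stub K1b — THE `J`-LINE OF R6b: THE STRETCHING BRACKET OF (INEQ)₃ IS CUBIC-SMALL (record §15/§18)

`--supports stmt-NavierStokesRegularity-21883` (helper).  Author: prover seat `ns-el-k1b` (g9).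

The left-hand side of (INEQ)₃ (`slideInequality_layer(Step)`) is `S·J` with the stretching bracket
`J = −(−∫γ₁⟪ω,Dvω⟫) + ∫γ₁T_A + ∫γ₂T_B` (`γ₁ = g′`, `γ₂ = g″`; `T_A`, `T_B` as in `…ConstantSpeedSlideCubicBounds`).  With the pointwise
bounds of that file and `‖ω‖ ≤ 4‖Dv‖` (`norm_curl_le_four_mul`, `…SlideVariationLipschitz`):
```
  |J| ≤ 128 ∫γ₁(x₂)‖Dv‖³ + 40σ ∫|γ₂(x₂)|‖Dv‖²        (‖v − c‖ ≤ σ where γ₂ ≠ 0, γ₁ ≥ 0),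
```
i.e. the `J`-line of the absorption ledger is a cubic gradient term (absorbed by `‖Dv‖³ ≤ ½(λ‖Dv‖² + λ⁻¹‖Dv‖⁴)` and the quartic line
`…SlideLayerGradientL4`) plus a `g″`-weighted energy with the small factor `σ`.
* `stretchingLine_abs_le` : the displayed bound, integrand shapes those of (INEQ)₃.

WHAT THIS IS NOT: K1b is NOT proved; nothing here proves NS regularity. [folklore]
-/

noncomputable section

open Set Filter Topology MeasureTheory Metric Function InnerProductSpace
open scoped ENNReal NNReal Topology InnerProductSpace RealInnerProductSpace ContDiff
open Literature.Analysis.FluidPDE Literature.Analysis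

namespace Summit.NavierStokesRegularity.NavierStokesRegularity.Theorems

-- the problem directory repeats the summit name (`NavierStokesRegularity/NavierStokesRegularity`)
set_option linter.dupNamespace false

namespace ExtremiserLiouville

open DepletionLadder.KStar

variable {v : EuclideanSpace ℝ (Fin 3) → EuclideanSpace ℝ (Fin 3)} {c : EuclideanSpace ℝ (Fin 3)} {γ₁ γ₂ : ℝ → ℝ}

/-- **The `J`-line bound.**  `v ∈ C^∞` with `‖Dv‖ ≤ B`, `D¹v ∈ L²`; weights `γ₁, γ₂` continuous with `0 ≤ γ₁ ≤ K₁`, `|γ₂| ≤ K₂`,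
`γ₂ = 0` for `|s| > T`; `‖v − c‖²` integrable on the slab `{|x₂| ≤ T}` and `‖v − c‖ ≤ σ` wherever `γ₂(x₂) ≠ 0`.  Then
`|J| ≤ 128∫γ₁‖Dv‖³ + 40σ∫|γ₂|‖Dv‖²`. [folklore] -/
theorem stretchingLine_abs_le (hv : ContDiff ℝ ∞ v) {B K₁ K₂ T σ : ℝ} (hB : ∀ x, ‖fderiv ℝ v x‖ ≤ B)
    (h1 : ∫⁻ x, ‖iteratedFDeriv ℝ 1 v x‖ₑ ^ 2 < ⊤)
    (hγ₁c : Continuous γ₁) (hγ₁0 : ∀ s, 0 ≤ γ₁ s) (hγ₁K : ∀ s, γ₁ s ≤ K₁)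
    (hγ₂c : Continuous γ₂) (hγ₂K : ∀ s, |γ₂ s| ≤ K₂) (hγ₂T : ∀ s, T < |s| → γ₂ s = 0)
    (hslab : Integrable (fun x => {x : EuclideanSpace ℝ (Fin 3) | |x 2| ≤ T}.indicator (fun x => ‖v x - c‖ ^ 2) x) volume)
    (hσ0 : 0 ≤ σ) (hσ : ∀ x : EuclideanSpace ℝ (Fin 3), γ₂ (x 2) ≠ 0 → ‖v x - c‖ ≤ σ) :
    |(-(-(∫ x : EuclideanSpace ℝ (Fin 3), γ₁ (x 2) * ⟪curl v x, fderiv ℝ v x (curl v x)⟫)) + (∫ x : EuclideanSpace ℝ (Fin 3), γ₁ (x 2) * (⟪((-2 * fderiv ℝ v x (EuclideanSpace.single (2 : Fin 3) (1 : ℝ)) 1) • EuclideanSpace.single (0 : Fin 3) (1 : ℝ) + (2 * fderiv ℝ v x (EuclideanSpace.single (2 : Fin 3) (1 : ℝ)) 0) • EuclideanSpace.single (1 : Fin 3) (1 : ℝ) + (curl v x 2) • EuclideanSpace.single (2 : Fin 3) (1 : ℝ)), fderiv ℝ v x (curl v x)⟫ + curl v x 2 * ⟪curl v x, fderiv ℝ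 v x (EuclideanSpace.single (2 : Fin 3) (1 : ℝ))⟫ + ⟪curl v x, fderiv ℝ v x (curl v x) - (fderiv ℝ v x (curl v x) 2) • EuclideanSpace.single (2 : Fin 3) (1 : ℝ)⟫ + ⟪curl v x, fderiv ℝ v x ((-2 * fderiv ℝ v x (EuclideanSpace.single (2 : Fin 3) (1 : ℝ)) 1) • EuclideanSpace.single (0 : Fin 3) (1 : ℝ) + (2 * fderiv ℝ v x (EuclideanSpace.single (2 : Fin 3) (1 : ℝ)) 0) • EuclideanSpace.single (1 : Fin 3) (1 : ℝ) + (curl v x 2) • EuclideanSpace.single (2 : Fin 3) (1 : ℝ))⟫)) + ∫ x : EuclideanSpace ℝ (Fin 3), γ₂ (x 2) * (⟪((-(v x - c) 1) • EuclideanSpace.single (0 : Fin 3) (1 : ℝ) + ((v x - c) 0) • EuclideanSpace.single (1 : Fin 3) (1 : ℝ)), fderiv ℝ v x (curl v x)⟫ + curl v x 2 * ⟪curl v x, v x - c - ((v x - c) 2) • EuclideanSpace.single (2 : Fin 3) (1 : ℝ)⟫ + ⟪curl v x, fderiv ℝ v x ((-(v x - c) 1) • EuclideanSpace.single (0 : Fin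 3) (1 : ℝ) + ((v x - c) 0) • EuclideanSpace.single (1 : Fin 3) (1 : ℝ))⟫))| ≤ 128 * (∫ x : EuclideanSpace ℝ (Fin 3), γ₁ (x 2) * ‖fderiv ℝ v x‖ ^ 3) + 40 * σ * ∫ x : EuclideanSpace ℝ (Fin 3), |γ₂ (x 2)| * ‖fderiv ℝ v x‖ ^ 2 := by
  have hK₁ : ∀ s, |γ₁ s| ≤ K₁ := fun s => by rw [abs_of_nonneg (hγ₁0 s)]; exact hγ₁K s
  have hK₁0 : 0 ≤ K₁ := (hγ₁0 0).trans (hγ₁K 0)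
  have hK₂0 : 0 ≤ K₂ := (abs_nonneg _).trans (hγ₂K 0)
  have hB0 : 0 ≤ B := (norm_nonneg _).trans (hB 0)
  -- integrability of the three pieces (tree lemmas; the cross part through `V = v − c`)
  have iJ0 : Integrable (fun x : EuclideanSpace ℝ (Fin 3) => γ₁ (x 2) * ⟪curl v x, fderiv ℝ v x (curl v x)⟫) volume := integrable_weight_mul_stretching hv hB h1 hγ₁c hK₁
  have iTA : Integrable (fun x : EuclideanSpace ℝ (Fin 3) => γ₁ (x 2) * (⟪((-2 * fderiv ℝ v x (EuclideanSpace.single (2 : Fin 3) (1 : ℝ)) 1) • EuclideanSpace.single (0 : Fin 3) (1 : ℝ) + (2 * fderiv ℝ v x (EuclideanSpace.single (2 : Fin 3) (1 : ℝ)) 0) • EuclideanSpace.single (1 : Fin 3) (1 : ℝ) + (curl v x 2) • EuclideanSpace.single (2 : Fin 3) (1 : ℝ)), fderiv ℝ v x (curl v x)⟫ + curl v x 2 * ⟪curl v x, fderiv ℝ v x (EuclideanSpace.single (2 : Fin 3) (1 : ℝ))⟫ + ⟪curl v x, fderiv ℝ v x (curl v x) - (fderiv ℝ v x (curl v x) 2)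 • EuclideanSpace.single (2 : Fin 3) (1 : ℝ)⟫ + ⟪curl v x, fderiv ℝ v x ((-2 * fderiv ℝ v x (EuclideanSpace.single (2 : Fin 3) (1 : ℝ)) 1) • EuclideanSpace.single (0 : Fin 3) (1 : ℝ) + (2 * fderiv ℝ v x (EuclideanSpace.single (2 : Fin 3) (1 : ℝ)) 0) • EuclideanSpace.single (1 : Fin 3) (1 : ℝ) + (curl v x 2) • EuclideanSpace.single (2 : Fin 3) (1 : ℝ))⟫)) volume := integrable_stretching_tangentPart hv hB h1 hγ₁c hK₁
  have hVs : ContDiff ℝ ∞ (fun y => v y - c) := hv.sub contDiff_const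
  have h1V : ∫⁻ x, ‖iteratedFDeriv ℝ 1 (fun y => v y - c) x‖ₑ ^ 2 < ⊤ := by
    have e1 : (fun x => ‖iteratedFDeriv ℝ 1 (fun y => v y - c) x‖ₑ ^ 2) = fun x => ‖iteratedFDeriv ℝ 1 v x‖ₑ ^ 2 := by
      funext x; rw [iteratedFDeriv_sub_const_of_ne hv c one_ne_zero]
    rw [e1]; exact h1
  have hB' : ∀ x, ‖fderiv ℝ (fun y => v y - c) x‖ ≤ B := fun x => by rw [fderiv_sub_const]; exact hB x
  have iTB : Integrable (fun x : EuclideanSpace ℝ (Fin 3) => γ₂ (x 2) * (⟪((-(v x - c) 1) • EuclideanSpace.single (0 : Fin 3) (1 : ℝ) + ((v x - c) 0) • EuclideanSpace.single (1 : Fin 3) (1 : ℝ)), fderiv ℝ v x (curl v x)⟫ + curl v x 2 * ⟪curl v x, v x - c - ((v x - c) 2) • EuclideanSpace.single (2 : Fin 3) (1 : ℝ)⟫ + ⟪curl v x, fderiv ℝ v x ((-(v x - c) 1) • EuclideanSpace.single (0 : Fin 3) (1 : ℝ) + ((v x - c) 0) • EuclideanSpace.single (1 : Fin 3) (1 : ℝ))⟫))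 volume := by
    have h := integrable_stretching_crossPart (V := fun y => v y - c) hVs hB' h1V hγ₂c hγ₂K hγ₂T hslab
    simp only [fderiv_sub_const, curl_sub_const] at h
    exact h
  -- `Dv ∈ L²` and the two majorants
  have hD1 : Integrable (fun x => ‖iteratedFDeriv ℝ 1 v x‖ ^ 2) (volume : Measure (EuclideanSpace ℝ (Fin 3))) :=
    integrable_sq_norm_of_lintegral (hv.continuous_iteratedFDeriv (WithTop.coe_le_coe.mpr le_top)) h1
  have i1 : Integrable (fun x => ‖fderiv ℝ v x‖ ^ 2) (volume : Measure (EuclideanSpace ℝ (Fin 3))) :=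
    hD1.congr (Eventually.of_forall fun x => by simp only; rw [← norm_iteratedFDeriv_fderiv, norm_iteratedFDeriv_zero])
  have cP : Continuous fun x : EuclideanSpace ℝ (Fin 3) => ‖fderiv ℝ v x‖ := ((hv.continuous_fderiv (by simp))).norm
  have cγ₁ : Continuous fun x : EuclideanSpace ℝ (Fin 3) => γ₁ (x 2) := hγ₁c.comp (PiLp.continuous_apply 2 _ (2 : Fin 3))
  have cγ₂ : Continuous fun x : EuclideanSpace ℝ (Fin 3) => γ₂ (x 2) := hγ₂c.comp (PiLp.continuous_apply 2 _ (2 : Fin 3))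
  have iP3 : Integrable (fun x : EuclideanSpace ℝ (Fin 3) => γ₁ (x 2) * ‖fderiv ℝ v x‖ ^ 3) volume := by
    refine (i1.const_mul (K₁ * B)).mono' (cγ₁.mul (cP.pow 3)).aestronglyMeasurable (Eventually.of_forall fun x => ?_)
    rw [Real.norm_eq_abs, abs_of_nonneg (mul_nonneg (hγ₁0 _) (by positivity))]
    have hP := norm_nonneg (fderiv ℝ v x)
    calc γ₁ (x 2) * ‖fderiv ℝ v x‖ ^ 3 = γ₁ (x 2) * ‖fderiv ℝ v x‖ * ‖fderiv ℝ v x‖ ^ 2 := by ring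
      _ ≤ K₁ * B * ‖fderiv ℝ v x‖ ^ 2 := mul_le_mul_of_nonneg_right (mul_le_mul (hγ₁K _) (hB x) hP hK₁0) (sq_nonneg _)
  have iP2 : Integrable (fun x : EuclideanSpace ℝ (Fin 3) => |γ₂ (x 2)| * ‖fderiv ℝ v x‖ ^ 2) volume := by
    refine (i1.const_mul K₂).mono' ((continuous_abs.comp cγ₂).mul (cP.pow 2)).aestronglyMeasurable (Eventually.of_forall fun x => ?_)
    rw [Real.norm_eq_abs, abs_of_nonneg (mul_nonneg (abs_nonneg _) (sq_nonneg _))]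
    exact mul_le_mul_of_nonneg_right (hγ₂K _) (sq_nonneg _)
  -- pointwise bounds
  have hW : ∀ x : EuclideanSpace ℝ (Fin 3), ‖curl v x‖ ≤ 4 * ‖fderiv ℝ v x‖ := fun x => norm_curl_le_four_mul v x
  have p0 : ∀ x : EuclideanSpace ℝ (Fin 3), |γ₁ (x 2) * ⟪curl v x, fderiv ℝ v x (curl v x)⟫| ≤ 16 * (γ₁ (x 2) * ‖fderiv ℝ v x‖ ^ 3) := fun x => by
    rw [abs_mul, abs_of_nonneg (hγ₁0 _)]
    have h := abs_inner_curl_fderiv_curl_le (V := v) x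
    have hw := hW x; have hP := norm_nonneg (fderiv ℝ v x); have hWn := norm_nonneg (curl v x); have hg := hγ₁0 (x 2)
    have h2 : ‖fderiv ℝ v x‖ * ‖curl v x‖ ^ 2 ≤ 16 * ‖fderiv ℝ v x‖ ^ 3 := by nlinarith [mul_nonneg hP hWn, pow_le_pow_left₀ hWn hw 2]
    nlinarith [mul_le_mul_of_nonneg_left (h.trans h2) hg]
  have pA : ∀ x : EuclideanSpace ℝ (Fin 3), |γ₁ (x 2) * (⟪((-2 * fderiv ℝ v x (EuclideanSpace.single (2 : Fin 3) (1 : ℝ)) 1) • EuclideanSpace.single (0 : Fin 3) (1 : ℝ) + (2 * fderiv ℝ v x (EuclideanSpace.single (2 : Fin 3) (1 : ℝ)) 0) • EuclideanSpace.single (1 : Fin 3) (1 : ℝ) + (curl v x 2) • EuclideanSpace.single (2 : Fin 3) (1 : ℝ)), fderiv ℝ v x (curl v x)⟫ + curl v x 2 * ⟪curl v x, fderiv ℝ v x (EuclideanSpace.single (2 : Fin 3) (1 : ℝ))⟫ + ⟪curl v x, fderiv ℝ v x (curl v x) - (fderiv ℝ v x (curl v x) 2) • EuclideanSpace.single (2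 : Fin 3) (1 : ℝ)⟫ + ⟪curl v x, fderiv ℝ v x ((-2 * fderiv ℝ v x (EuclideanSpace.single (2 : Fin 3) (1 : ℝ)) 1) • EuclideanSpace.single (0 : Fin 3) (1 : ℝ) + (2 * fderiv ℝ v x (EuclideanSpace.single (2 : Fin 3) (1 : ℝ)) 0) • EuclideanSpace.single (1 : Fin 3) (1 : ℝ) + (curl v x 2) • EuclideanSpace.single (2 : Fin 3) (1 : ℝ))⟫)| ≤ 112 * (γ₁ (x 2) * ‖fderiv ℝ v x‖ ^ 3) := fun x => by
    rw [abs_mul, abs_of_nonneg (hγ₁0 _)]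
    have h := abs_stretchingTangent_le (V := v) x
    have hw := hW x; have hP := norm_nonneg (fderiv ℝ v x); have hWn := norm_nonneg (curl v x); have hg := hγ₁0 (x 2)
    have h2 : 8 * ‖fderiv ℝ v x‖ ^ 2 * ‖curl v x‖ + 5 * ‖fderiv ℝ v x‖ * ‖curl v x‖ ^ 2 ≤ 112 * ‖fderiv ℝ v x‖ ^ 3 := by
      nlinarith [mul_nonneg hP hWn, mul_nonneg (sq_nonneg ‖fderiv ℝ v x‖) hWn, pow_le_pow_left₀ hWn hw 2, mul_le_mul_of_nonneg_left hw (sq_nonneg ‖fderiv ℝ v x‖),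
        mul_le_mul_of_nonneg_left (pow_le_pow_left₀ hWn hw 2) hP]
    nlinarith [mul_le_mul_of_nonneg_left (h.trans h2) hg]
  have pB : ∀ x : EuclideanSpace ℝ (Fin 3), |γ₂ (x 2) * (⟪((-(v x - c) 1) • EuclideanSpace.single (0 : Fin 3) (1 : ℝ) + ((v x - c) 0) • EuclideanSpace.single (1 : Fin 3) (1 : ℝ)), fderiv ℝ v x (curl v x)⟫ + curl v x 2 * ⟪curl v x, v x - c - ((v x - c) 2) • EuclideanSpace.single (2 : Fin 3) (1 : ℝ)⟫ + ⟪curl v x, fderiv ℝ v x ((-(v x - c) 1) • EuclideanSpace.single (0 : Fin 3) (1 : ℝ) + ((v x - c) 0) • EuclideanSpace.single (1 : Fin 3) (1 : ℝ))⟫)| ≤ 40 * σ * (|γ₂ (x 2)| * ‖fderiv ℝ v x‖ ^ 2) := fun x => by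
    by_cases h0 : γ₂ (x 2) = 0
    · rw [h0]; simp
    rw [abs_mul]
    have h := abs_stretchingCross_le (V := v) x (v x - c)
    have hVσ := hσ x h0
    have hw := hW x; have hP := norm_nonneg (fderiv ℝ v x); have hWn := norm_nonneg (curl v x); have hY := norm_nonneg (v x - c)
    have h2 : 2 * ‖v x - c‖ * ‖fderiv ℝ v x‖ * ‖curl v x‖ + 2 * ‖v x - c‖ * ‖curl v x‖ ^ 2 ≤ 40 * σ * ‖fderiv ℝ v x‖ ^ 2 := by
      have a1 : ‖v x - c‖ * (‖fderiv ℝ v x‖ * ‖curl v x‖) ≤ σ * (4 * ‖fderiv ℝ v x‖ ^ 2) :=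
        mul_le_mul hVσ (by nlinarith [mul_le_mul_of_nonneg_left hw hP]) (mul_nonneg hP hWn) hσ0
      have a2 : ‖v x - c‖ * ‖curl v x‖ ^ 2 ≤ σ * (16 * ‖fderiv ℝ v x‖ ^ 2) :=
        mul_le_mul hVσ (by nlinarith [pow_le_pow_left₀ hWn hw 2]) (sq_nonneg _) hσ0
      nlinarith [a1, a2]
    nlinarith [mul_le_mul_of_nonneg_left (h.trans h2) (abs_nonneg (γ₂ (x 2))), abs_nonneg (γ₂ (x 2))]
  -- integrate
  have I0 : |∫ x : EuclideanSpace ℝ (Fin 3), γ₁ (x 2) * ⟪curl v x, fderiv ℝ v x (curl v x)⟫| ≤ 16 * ∫ x : EuclideanSpace ℝ (Fin 3), γ₁ (x 2) * ‖fderiv ℝ v x‖ ^ 3 := by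
    refine (abs_integral_le_integral_abs).trans ?_
    rw [← integral_const_mul]
    exact integral_mono iJ0.abs (iP3.const_mul _) p0
  have IA : |∫ x : EuclideanSpace ℝ (Fin 3), γ₁ (x 2) * (⟪((-2 * fderiv ℝ v x (EuclideanSpace.single (2 : Fin 3) (1 : ℝ)) 1) • EuclideanSpace.single (0 : Fin 3) (1 : ℝ) + (2 * fderiv ℝ v x (EuclideanSpace.single (2 : Fin 3) (1 : ℝ)) 0) • EuclideanSpace.single (1 : Fin 3) (1 : ℝ) + (curl v x 2) • EuclideanSpace.single (2 : Fin 3) (1 : ℝ)), fderiv ℝ v x (curl v x)⟫ + curl v x 2 * ⟪curl v x, fderiv ℝ v x (EuclideanSpace.single (2 : Fin 3) (1 : ℝ))⟫ + ⟪curl v x, fderiv ℝ v x (curl v x) - (fderiv ℝ v x (curl v x) 2) • EuclideanSpace.single (2 : Fin 3) (1 : ℝ)⟫ + ⟪curl v x, fderiv ℝ v x ((-2 * fderiv ℝ v x (EuclideanSpace.single (2 : Fin 3) (1 : ℝ)) 1) • EuclideanSpace.single (0 : Fin 3) (1 : ℝ) + (2 * fderiv ℝ v x (EuclideanSpace.single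 (2 : Fin 3) (1 : ℝ)) 0) • EuclideanSpace.single (1 : Fin 3) (1 : ℝ) + (curl v x 2) • EuclideanSpace.single (2 : Fin 3) (1 : ℝ))⟫)| ≤ 112 * ∫ x : EuclideanSpace ℝ (Fin 3), γ₁ (x 2) * ‖fderiv ℝ v x‖ ^ 3 := by
    refine (abs_integral_le_integral_abs).trans ?_
    rw [← integral_const_mul]
    exact integral_mono iTA.abs (iP3.const_mul _) pA
  have IB : |∫ x : EuclideanSpace ℝ (Fin 3), γ₂ (x 2) * (⟪((-(v x - c) 1) • EuclideanSpace.single (0 : Fin 3) (1 : ℝ) + ((v x - c) 0) • EuclideanSpace.single (1 : Fin 3) (1 : ℝ)), fderiv ℝ v x (curl v x)⟫ + curl v x 2 * ⟪curl v x, v x - c - ((v x - c) 2) • EuclideanSpace.single (2 : Fin 3) (1 : ℝ)⟫ + ⟪curl v x, fderiv ℝ v x ((-(v x - c) 1) • EuclideanSpace.single (0 : Fin 3) (1 : ℝ) + ((v x - c) 0) • EuclideanSpace.single (1 : Fin 3) (1 : ℝ))⟫)| ≤ 40 * σ * ∫ x : EuclideanSpace ℝ (Fin 3), |γ₂ (x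 2)| * ‖fderiv ℝ v x‖ ^ 2 := by
    refine (abs_integral_le_integral_abs).trans ?_
    rw [← integral_const_mul]
    exact integral_mono iTB.abs (iP2.const_mul _) pB
  have hA0 := abs_le.mp I0; have hA1 := abs_le.mp IA; have hA2 := abs_le.mp IB
  rw [abs_le]
  constructor <;> linarith [hA0.1, hA0.2, hA1.1, hA1.2, hA2.1, hA2.2]

/-- **The `J`-line bound for the bracket of (INEQ)₃ verbatim** (`J = −(−∫γ₁⟪ω,Dvω⟫ + ∫γ₁T_A + ∫γ₂T_B)`; same bound as
`stretchingLine_abs_le`, whose bracket carries the opposite inner signs).  `v ∈ C^∞` with `‖Dv‖ ≤ B`, `D¹v ∈ L²`; weights `γ₁, γ₂` continuous with `0 ≤ γ₁ ≤ K₁`, `|γ₂| ≤ K₂`,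
`γ₂ = 0` for `|s| > T`; `‖v − c‖²` integrable on the slab `{|x₂| ≤ T}` and `‖v − c‖ ≤ σ` wherever `γ₂(x₂) ≠ 0`.  Then
`|J| ≤ 128∫γ₁‖Dv‖³ + 40σ∫|γ₂|‖Dv‖²`. [folklore] -/
theorem stretchingBracket_abs_le (hv : ContDiff ℝ ∞ v) {B K₁ K₂ T σ : ℝ} (hB : ∀ x, ‖fderiv ℝ v x‖ ≤ B)
    (h1 : ∫⁻ x, ‖iteratedFDeriv ℝ 1 v x‖ₑ ^ 2 < ⊤)
    (hγ₁c : Continuous γ₁) (hγ₁0 : ∀ s, 0 ≤ γ₁ s) (hγ₁K : ∀ s, γ₁ s ≤ K₁)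
    (hγ₂c : Continuous γ₂) (hγ₂K : ∀ s, |γ₂ s| ≤ K₂) (hγ₂T : ∀ s, T < |s| → γ₂ s = 0)
    (hslab : Integrable (fun x => {x : EuclideanSpace ℝ (Fin 3) | |x 2| ≤ T}.indicator (fun x => ‖v x - c‖ ^ 2) x) volume)
    (hσ0 : 0 ≤ σ) (hσ : ∀ x : EuclideanSpace ℝ (Fin 3), γ₂ (x 2) ≠ 0 → ‖v x - c‖ ≤ σ) :
    |(-(-(∫ x, γ₁ (x 2) * ⟪curl v x, fderiv ℝ v x (curl v x)⟫) +
          (∫ x, γ₁ (x 2) *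
          (⟪((-2 * fderiv ℝ v x (EuclideanSpace.single (2 : Fin 3) (1 : ℝ)) 1) • EuclideanSpace.single (0 : Fin 3) (1 : ℝ) + (2 * fderiv ℝ v x (EuclideanSpace.single (2 : Fin 3) (1 : ℝ)) 0) • EuclideanSpace.single (1 : Fin 3) (1 : ℝ) + (curl v x 2) • EuclideanSpace.single (2 : Fin 3) (1 : ℝ)), fderiv ℝ v x (curl v x)⟫ +
            curl v x 2 * ⟪curl v x, fderiv ℝ v x (EuclideanSpace.single (2 : Fin 3) (1 : ℝ))⟫ +
            ⟪curl v x, fderiv ℝ v x (curl v x) - (fderiv ℝ v x (curl v x) 2) • EuclideanSpace.single (2 : Fin 3) (1 : ℝ)⟫ +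
            ⟪curl v x, fderiv ℝ v x ((-2 * fderiv ℝ v x (EuclideanSpace.single (2 : Fin 3) (1 : ℝ)) 1) • EuclideanSpace.single (0 : Fin 3) (1 : ℝ) + (2 * fderiv ℝ v x (EuclideanSpace.single (2 : Fin 3) (1 : ℝ)) 0) • EuclideanSpace.single (1 : Fin 3) (1 : ℝ) + (curl v x 2) • EuclideanSpace.single (2 : Fin 3) (1 : ℝ))⟫)) +
          ∫ x, γ₂ (x 2) *
          (⟪((-(v x - c) 1) • EuclideanSpace.single (0 : Fin 3) (1 : ℝ) + ((v x - c) 0) • EuclideanSpace.single (1 : Fin 3) (1 : ℝ)), fderiv ℝ v x (curl v x)⟫ +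
            curl v x 2 * ⟪curl v x, v x - c - ((v x - c) 2) • EuclideanSpace.single (2 : Fin 3) (1 : ℝ)⟫ +
            ⟪curl v x, fderiv ℝ v x ((-(v x - c) 1) • EuclideanSpace.single (0 : Fin 3) (1 : ℝ) + ((v x - c) 0) • EuclideanSpace.single (1 : Fin 3) (1 : ℝ))⟫)))| ≤ 128 * (∫ x : EuclideanSpace ℝ (Fin 3), γ₁ (x 2) * ‖fderiv ℝ v x‖ ^ 3) + 40 * σ * ∫ x : EuclideanSpace ℝ (Fin 3), |γ₂ (x 2)| * ‖fderiv ℝ v x‖ ^ 2 := by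
  have hK₁ : ∀ s, |γ₁ s| ≤ K₁ := fun s => by rw [abs_of_nonneg (hγ₁0 s)]; exact hγ₁K s
  have hK₁0 : 0 ≤ K₁ := (hγ₁0 0).trans (hγ₁K 0)
  have hK₂0 : 0 ≤ K₂ := (abs_nonneg _).trans (hγ₂K 0)
  have hB0 : 0 ≤ B := (norm_nonneg _).trans (hB 0)
  -- integrability of the three pieces (tree lemmas; the cross part through `V = v − c`)
  have iJ0 : Integrable (fun x : EuclideanSpace ℝ (Fin 3) => γ₁ (x 2) * ⟪curl v x, fderiv ℝ v x (curl v x)⟫) volume := integrable_weight_mul_stretching hv hB h1 hγ₁c hK₁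
  have iTA : Integrable (fun x : EuclideanSpace ℝ (Fin 3) => γ₁ (x 2) * (⟪((-2 * fderiv ℝ v x (EuclideanSpace.single (2 : Fin 3) (1 : ℝ)) 1) • EuclideanSpace.single (0 : Fin 3) (1 : ℝ) + (2 * fderiv ℝ v x (EuclideanSpace.single (2 : Fin 3) (1 : ℝ)) 0) • EuclideanSpace.single (1 : Fin 3) (1 : ℝ) + (curl v x 2) • EuclideanSpace.single (2 : Fin 3) (1 : ℝ)), fderiv ℝ v x (curl v x)⟫ + curl v x 2 * ⟪curl v x, fderiv ℝ v x (EuclideanSpace.single (2 : Fin 3) (1 : ℝ))⟫ + ⟪curl v x, fderiv ℝ v x (curl v x) - (fderiv ℝ v x (curl v x) 2) • EuclideanSpace.single (2 : Fin 3) (1 : ℝ)⟫ + ⟪curl v x, fderiv ℝ v x ((-2 * fderiv ℝ v x (EuclideanSpace.single (2 : Fin 3) (1 : ℝ)) 1) • EuclideanSpace.single (0 : Fin 3) (1 : ℝ) + (2 * fderiv ℝ v x (EuclideanSpace.single (2 : Fin 3) (1 : ℝ)) 0) • EuclideanSpace.single (1 : Fin 3) (1 : ℝ) + (curl v x 2)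 • EuclideanSpace.single (2 : Fin 3) (1 : ℝ))⟫)) volume := integrable_stretching_tangentPart hv hB h1 hγ₁c hK₁
  have hVs : ContDiff ℝ ∞ (fun y => v y - c) := hv.sub contDiff_const
  have h1V : ∫⁻ x, ‖iteratedFDeriv ℝ 1 (fun y => v y - c) x‖ₑ ^ 2 < ⊤ := by
    have e1 : (fun x => ‖iteratedFDeriv ℝ 1 (fun y => v y - c) x‖ₑ ^ 2) = fun x => ‖iteratedFDeriv ℝ 1 v x‖ₑ ^ 2 := by
      funext x; rw [iteratedFDeriv_sub_const_of_ne hv c one_ne_zero]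
    rw [e1]; exact h1
  have hB' : ∀ x, ‖fderiv ℝ (fun y => v y - c) x‖ ≤ B := fun x => by rw [fderiv_sub_const]; exact hB x
  have iTB : Integrable (fun x : EuclideanSpace ℝ (Fin 3) => γ₂ (x 2) * (⟪((-(v x - c) 1) • EuclideanSpace.single (0 : Fin 3) (1 : ℝ) + ((v x - c) 0) • EuclideanSpace.single (1 : Fin 3) (1 : ℝ)), fderiv ℝ v x (curl v x)⟫ + curl v x 2 * ⟪curl v x, v x - c - ((v x - c) 2) • EuclideanSpace.single (2 : Fin 3) (1 : ℝ)⟫ + ⟪curl v x, fderiv ℝ v x ((-(v x - c) 1) • EuclideanSpace.single (0 : Fin 3) (1 : ℝ) + ((v x - c) 0) • EuclideanSpace.single (1 : Fin 3) (1 : ℝ))⟫)) volume := by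
    have h := integrable_stretching_crossPart (V := fun y => v y - c) hVs hB' h1V hγ₂c hγ₂K hγ₂T hslab
    simp only [fderiv_sub_const, curl_sub_const] at h
    exact h
  -- `Dv ∈ L²` and the two majorants
  have hD1 : Integrable (fun x => ‖iteratedFDeriv ℝ 1 v x‖ ^ 2) (volume : Measure (EuclideanSpace ℝ (Fin 3))) :=
    integrable_sq_norm_of_lintegral (hv.continuous_iteratedFDeriv (WithTop.coe_le_coe.mpr le_top)) h1
  have i1 : Integrable (fun x => ‖fderiv ℝ v x‖ ^ 2) (volume : Measure (EuclideanSpace ℝ (Fin 3))) :=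
    hD1.congr (Eventually.of_forall fun x => by simp only; rw [← norm_iteratedFDeriv_fderiv, norm_iteratedFDeriv_zero])
  have cP : Continuous fun x : EuclideanSpace ℝ (Fin 3) => ‖fderiv ℝ v x‖ := ((hv.continuous_fderiv (by simp))).norm
  have cγ₁ : Continuous fun x : EuclideanSpace ℝ (Fin 3) => γ₁ (x 2) := hγ₁c.comp (PiLp.continuous_apply 2 _ (2 : Fin 3))
  have cγ₂ : Continuous fun x : EuclideanSpace ℝ (Fin 3) => γ₂ (x 2) := hγ₂c.comp (PiLp.continuous_apply 2 _ (2 : Fin 3))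
  have iP3 : Integrable (fun x : EuclideanSpace ℝ (Fin 3) => γ₁ (x 2) * ‖fderiv ℝ v x‖ ^ 3) volume := by
    refine (i1.const_mul (K₁ * B)).mono' (cγ₁.mul (cP.pow 3)).aestronglyMeasurable (Eventually.of_forall fun x => ?_)
    rw [Real.norm_eq_abs, abs_of_nonneg (mul_nonneg (hγ₁0 _) (by positivity))]
    have hP := norm_nonneg (fderiv ℝ v x)
    calc γ₁ (x 2) * ‖fderiv ℝ v x‖ ^ 3 = γ₁ (x 2) * ‖fderiv ℝ v x‖ * ‖fderiv ℝ v x‖ ^ 2 := by ring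
      _ ≤ K₁ * B * ‖fderiv ℝ v x‖ ^ 2 := mul_le_mul_of_nonneg_right (mul_le_mul (hγ₁K _) (hB x) hP hK₁0) (sq_nonneg _)
  have iP2 : Integrable (fun x : EuclideanSpace ℝ (Fin 3) => |γ₂ (x 2)| * ‖fderiv ℝ v x‖ ^ 2) volume := by
    refine (i1.const_mul K₂).mono' ((continuous_abs.comp cγ₂).mul (cP.pow 2)).aestronglyMeasurable (Eventually.of_forall fun x => ?_)
    rw [Real.norm_eq_abs, abs_of_nonneg (mul_nonneg (abs_nonneg _) (sq_nonneg _))]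
    exact mul_le_mul_of_nonneg_right (hγ₂K _) (sq_nonneg _)
  -- pointwise bounds
  have hW : ∀ x : EuclideanSpace ℝ (Fin 3), ‖curl v x‖ ≤ 4 * ‖fderiv ℝ v x‖ := fun x => norm_curl_le_four_mul v x
  have p0 : ∀ x : EuclideanSpace ℝ (Fin 3), |γ₁ (x 2) * ⟪curl v x, fderiv ℝ v x (curl v x)⟫| ≤ 16 * (γ₁ (x 2) * ‖fderiv ℝ v x‖ ^ 3) := fun x => by
    rw [abs_mul, abs_of_nonneg (hγ₁0 _)]
    have h := abs_inner_curl_fderiv_curl_le (V := v) x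
    have hw := hW x; have hP := norm_nonneg (fderiv ℝ v x); have hWn := norm_nonneg (curl v x); have hg := hγ₁0 (x 2)
    have h2 : ‖fderiv ℝ v x‖ * ‖curl v x‖ ^ 2 ≤ 16 * ‖fderiv ℝ v x‖ ^ 3 := by nlinarith [mul_nonneg hP hWn, pow_le_pow_left₀ hWn hw 2]
    nlinarith [mul_le_mul_of_nonneg_left (h.trans h2) hg]
  have pA : ∀ x : EuclideanSpace ℝ (Fin 3), |γ₁ (x 2) * (⟪((-2 * fderiv ℝ v x (EuclideanSpace.single (2 : Fin 3) (1 : ℝ)) 1) • EuclideanSpace.single (0 : Fin 3) (1 : ℝ) + (2 * fderiv ℝ v x (EuclideanSpace.single (2 : Fin 3) (1 : ℝ)) 0) • EuclideanSpace.single (1 : Fin 3) (1 : ℝ) + (curl v x 2) • EuclideanSpace.single (2 : Fin 3) (1 : ℝ)), fderiv ℝ v x (curl v x)⟫ + curl v x 2 * ⟪curl v x, fderiv ℝ v x (EuclideanSpace.single (2 : Fin 3) (1 : ℝ))⟫ + ⟪curl v x, fderiv ℝ v x (curl v x) - (fderiv ℝ v x (curl v x) 2) • EuclideanSpace.single (2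 : Fin 3) (1 : ℝ)⟫ + ⟪curl v x, fderiv ℝ v x ((-2 * fderiv ℝ v x (EuclideanSpace.single (2 : Fin 3) (1 : ℝ)) 1) • EuclideanSpace.single (0 : Fin 3) (1 : ℝ) + (2 * fderiv ℝ v x (EuclideanSpace.single (2 : Fin 3) (1 : ℝ)) 0) • EuclideanSpace.single (1 : Fin 3) (1 : ℝ) + (curl v x 2) • EuclideanSpace.single (2 : Fin 3) (1 : ℝ))⟫)| ≤ 112 * (γ₁ (x 2) * ‖fderiv ℝ v x‖ ^ 3) := fun x => by
    rw [abs_mul, abs_of_nonneg (hγ₁0 _)]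
    have h := abs_stretchingTangent_le (V := v) x
    have hw := hW x; have hP := norm_nonneg (fderiv ℝ v x); have hWn := norm_nonneg (curl v x); have hg := hγ₁0 (x 2)
    have h2 : 8 * ‖fderiv ℝ v x‖ ^ 2 * ‖curl v x‖ + 5 * ‖fderiv ℝ v x‖ * ‖curl v x‖ ^ 2 ≤ 112 * ‖fderiv ℝ v x‖ ^ 3 := by
      nlinarith [mul_nonneg hP hWn, mul_nonneg (sq_nonneg ‖fderiv ℝ v x‖) hWn, pow_le_pow_left₀ hWn hw 2, mul_le_mul_of_nonneg_left hw (sq_nonneg ‖fderiv ℝ v x‖),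
        mul_le_mul_of_nonneg_left (pow_le_pow_left₀ hWn hw 2) hP]
    nlinarith [mul_le_mul_of_nonneg_left (h.trans h2) hg]
  have pB : ∀ x : EuclideanSpace ℝ (Fin 3), |γ₂ (x 2) * (⟪((-(v x - c) 1) • EuclideanSpace.single (0 : Fin 3) (1 : ℝ) + ((v x - c) 0) • EuclideanSpace.single (1 : Fin 3) (1 : ℝ)), fderiv ℝ v x (curl v x)⟫ + curl v x 2 * ⟪curl v x, v x - c - ((v x - c) 2) • EuclideanSpace.single (2 : Fin 3) (1 : ℝ)⟫ + ⟪curl v x, fderiv ℝ v x ((-(v x - c) 1) • EuclideanSpace.single (0 : Fin 3) (1 : ℝ) + ((v x - c) 0) • EuclideanSpace.single (1 : Fin 3) (1 : ℝ))⟫)| ≤ 40 * σ * (|γ₂ (x 2)| * ‖fderiv ℝ v x‖ ^ 2) := fun x => by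
    by_cases h0 : γ₂ (x 2) = 0
    · rw [h0]; simp
    rw [abs_mul]
    have h := abs_stretchingCross_le (V := v) x (v x - c)
    have hVσ := hσ x h0
    have hw := hW x; have hP := norm_nonneg (fderiv ℝ v x); have hWn := norm_nonneg (curl v x); have hY := norm_nonneg (v x - c)
    have h2 : 2 * ‖v x - c‖ * ‖fderiv ℝ v x‖ * ‖curl v x‖ + 2 * ‖v x - c‖ * ‖curl v x‖ ^ 2 ≤ 40 * σ * ‖fderiv ℝ v x‖ ^ 2 := by
      have a1 : ‖v x - c‖ * (‖fderiv ℝ v x‖ * ‖curl v x‖) ≤ σ * (4 * ‖fderiv ℝ v x‖ ^ 2) :=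
        mul_le_mul hVσ (by nlinarith [mul_le_mul_of_nonneg_left hw hP]) (mul_nonneg hP hWn) hσ0
      have a2 : ‖v x - c‖ * ‖curl v x‖ ^ 2 ≤ σ * (16 * ‖fderiv ℝ v x‖ ^ 2) :=
        mul_le_mul hVσ (by nlinarith [pow_le_pow_left₀ hWn hw 2]) (sq_nonneg _) hσ0
      nlinarith [a1, a2]
    nlinarith [mul_le_mul_of_nonneg_left (h.trans h2) (abs_nonneg (γ₂ (x 2))), abs_nonneg (γ₂ (x 2))]
  -- integrate
  have I0 : |∫ x : EuclideanSpace ℝ (Fin 3), γ₁ (x 2) * ⟪curl v x, fderiv ℝ v x (curl v x)⟫| ≤ 16 * ∫ x : EuclideanSpace ℝ (Fin 3), γ₁ (x 2) * ‖fderiv ℝ v x‖ ^ 3 := by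
    refine (abs_integral_le_integral_abs).trans ?_
    rw [← integral_const_mul]
    exact integral_mono iJ0.abs (iP3.const_mul _) p0
  have IA : |∫ x : EuclideanSpace ℝ (Fin 3), γ₁ (x 2) * (⟪((-2 * fderiv ℝ v x (EuclideanSpace.single (2 : Fin 3) (1 : ℝ)) 1) • EuclideanSpace.single (0 : Fin 3) (1 : ℝ) + (2 * fderiv ℝ v x (EuclideanSpace.single (2 : Fin 3) (1 : ℝ)) 0) • EuclideanSpace.single (1 : Fin 3) (1 : ℝ) + (curl v x 2) • EuclideanSpace.single (2 : Fin 3) (1 : ℝ)), fderiv ℝ v x (curl v x)⟫ + curl v x 2 * ⟪curl v x, fderiv ℝ v x (EuclideanSpace.single (2 : Fin 3) (1 : ℝ))⟫ + ⟪curl v x, fderiv ℝ v x (curl v x) - (fderiv ℝ v x (curl v x) 2) • EuclideanSpace.single (2 : Fin 3) (1 : ℝ)⟫ + ⟪curl v x, fderiv ℝ v x ((-2 * fderiv ℝ v x (EuclideanSpace.single (2 : Fin 3) (1 : ℝ)) 1) • EuclideanSpace.single (0 : Fin 3) (1 : ℝ) + (2 * fderiv ℝ v x (EuclideanSpace.single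 (2 : Fin 3) (1 : ℝ)) 0) • EuclideanSpace.single (1 : Fin 3) (1 : ℝ) + (curl v x 2) • EuclideanSpace.single (2 : Fin 3) (1 : ℝ))⟫)| ≤ 112 * ∫ x : EuclideanSpace ℝ (Fin 3), γ₁ (x 2) * ‖fderiv ℝ v x‖ ^ 3 := by
    refine (abs_integral_le_integral_abs).trans ?_
    rw [← integral_const_mul]
    exact integral_mono iTA.abs (iP3.const_mul _) pA
  have IB : |∫ x : EuclideanSpace ℝ (Fin 3), γ₂ (x 2) * (⟪((-(v x - c) 1) • EuclideanSpace.single (0 : Fin 3) (1 : ℝ) + ((v x - c) 0) • EuclideanSpace.single (1 : Fin 3) (1 : ℝ)), fderiv ℝ v x (curl v x)⟫ + curl v x 2 * ⟪curl v x, v x - c - ((v x - c) 2) • EuclideanSpace.single (2 : Fin 3) (1 : ℝ)⟫ + ⟪curl v x, fderiv ℝ v x ((-(v x - c) 1) • EuclideanSpace.single (0 : Fin 3) (1 : ℝ) + ((v x - c) 0) • EuclideanSpace.single (1 : Fin 3) (1 : ℝ))⟫)| ≤ 40 * σ * ∫ x : EuclideanSpace ℝ (Fin 3), |γ₂ (x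 2)| * ‖fderiv ℝ v x‖ ^ 2 := by
    refine (abs_integral_le_integral_abs).trans ?_
    rw [← integral_const_mul]
    exact integral_mono iTB.abs (iP2.const_mul _) pB
  have hA0 := abs_le.mp I0; have hA1 := abs_le.mp IA; have hA2 := abs_le.mp IB
  rw [abs_le]
  constructor <;> linarith [hA0.1, hA0.2, hA1.1, hA1.2, hA2.1, hA2.2]

end ExtremiserLiouville

end Summit.NavierStokesRegularity.NavierStokesRegularity.Theorems

end
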